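import Literature.MathematicalPhysics.QuantumFieldTheory.ConstructiveQFTWave0Proofs
import Literature.MathematicalPhysics.QuantumFieldTheory.LatticeSiteRPMechanism
import HarnessLib

/-!
# Reflection positivity of the Wilson lattice gauge theory on the ODD torus

Theorem-only companion of `ConstructiveQFTWave0Proofs` (even torus, reflection `θ t = 1 - t` in
the two hyperplanes between time slices) and `ConstructiveQFTWave0SiteRPProofs` (even torus,
reflection `θ' t = -t` in the two hyperplanes through time slices). On the torus `(ℤ/Lℤ)^d` with
`L = 2m + 1` ODD the reflection `θ t = 1 - t` (`Site.timeReflect`, `GaugeConfig.timeReflect` of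
Wave 0) fixes ONE hyperplane between time slices (`t = 1/2`, crossed by the temporal links
`0 → 1`) and ONE hyperplane through sites (`t = m + 1`, since `1 - (m+1) ≡ m + 1`). This is the
"mixed situation forced by an odd period" anticipated by the abstract mechanism
`LatticeRP.integral_mul_conj_mul_exp_nonneg_of_shared` (`LatticeSiteRPMechanism`): the crossing
links `C` at `t = 0` are split `U_e ↦ U_e Y_e` (Osterwalder–Seiler), the spatial links `M` of the
slice `t = m + 1` form the shared block, and the positive block `P` consists of the links with
`1 ≤ t ≤ m` (time of the base point; temporal links `m → m + 1` included).

We prove reflection positivity directly in the covariant form needed for Wilson loops bisected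
by the hyperplane `t = 1/2` (cf. `ConstructiveQFTWave0CovariantRPProofs`): if a measurable
observable `Φ` satisfies `Φ (translateLow Y U) = ∑ₖ gₖ(splice_C(U, Y)) conj gₖ(Θ U)` for finitely
many bounded measurable `gₖ` depending only on `P ∪ C ∪ M`, then `⟨Φ⟩_{Λ,β} ≥ 0` (`β ≥ 0`,
continuous `ρ`, `L` odd, `L ≥ 3`): `wilsonExpectation_nonneg_of_oddCovariant`. Observables
`conj F(ΘU) F(U)` with `F` depending on `P ∪ M` are the special case `gₖ = F`
(`wilsonExpectation_oddReflectionPositive`).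

Infinite-volume limit points are limits along ARBITRARY subsequences of torus sizes, so the
transfer-matrix argument for the static potential / string tension (Seiler LNP 159 §2) needs the
odd tori as well as the even ones. The bookkeeping of `WilsonRP` that refers to the second
hyperplane of the even torus (`IsPosEdge`, `IsCrossEdge`, `translate`, `coeff`) is replaced here;
its parity-free parts (site arithmetic, `edgeReflect`, `plaqReflect`, `plaqRe_timeReflect`,
`halfPlaq`, `IsLowerCross`, `measurePreserving_timeReflect`, entry measurability) are reused.

References: K. Osterwalder, E. Seiler, Ann. Phys. 110 (1978) 440, §2; E. Seiler, LNP 159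
(1982), Ch. 2; J. Fröhlich, R. Israel, E. Lieb, B. Simon, Comm. Math. Phys. 62 (1978) 1,
Thm. 2.1. All statements here are proved. [folklore]
-/

open MeasureTheory Finset Complex
open scoped ComplexOrder ENNReal ComplexConjugate

namespace Literature.MathematicalPhysics.QuantumFieldTheory

noncomputable section

namespace WilsonOddRP

open WilsonRP
open Literature.RepresentationTheory.CompactGroups

/-! ## Odd time arithmetic -/

section Val

variable {d L : ℕ} [NeZero d] [NeZero L] [Fact (1 < L)]

omit [Fact (1 < L)] in
/-- On the site hyperplane `t = L/2 + 1` of the odd torus the reflection `θ t = 1 - t` fixes the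
site (`2 (m + 1) = L + 1 ≡ 1`). [folklore] -/
theorem timeReflect_of_val_eq (hL : Odd L) {x : Site d L} (h : (x 0).val = L / 2 + 1) :
    x.timeReflect = x := by
  obtain ⟨m, hm⟩ := hL
  have hdiv : L / 2 = m := by omega
  have hx : x 0 = ((m + 1 : ℕ) : ZMod L) := by
    rw [← ZMod.natCast_zmod_val (x 0), h, hdiv]
  have h2 : x 0 + x 0 = 1 := by
    rw [hx, ← Nat.cast_add, show m + 1 + (m + 1) = L + 1 by omega, Nat.cast_add, ZMod.natCast_self,
      zero_add, Nat.cast_one]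
  funext k
  by_cases hk : k = 0
  · subst hk
    rw [timeReflect_apply_zero]
    linear_combination (-1 : ZMod L) * h2
  · rw [timeReflect_apply_of_ne _ hk]

end Val

/-! ## Classification of links and plaquettes of the odd torus -/

section Classification

variable {d L : ℕ} [NeZero d]

/-- Positive links of the odd torus: base point in the slices `1 ≤ t ≤ L/2` (both temporal and
spatial links; the temporal links `L/2 → L/2 + 1` end on the site hyperplane). [folklore] -/
def IsOPosEdge (e : Edge d L) : Prop := 1 ≤ (e.1 0).val ∧ (e.1 0).val ≤ L / 2

/-- Shared links: spatial links inside the site hyperplane `t = L/2 + 1`. [folklore] -/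
def IsOSharedEdge (e : Edge d L) : Prop := e.2 ≠ 0 ∧ (e.1 0).val = L / 2 + 1

/-- Positive plaquettes: base point in the slices `1 ≤ t ≤ L/2`. [folklore] -/
def IsOPosPlaq (p : Plaquette d L) : Prop := 1 ≤ (p.1 0).val ∧ (p.1 0).val ≤ L / 2

/-- Crossing plaquettes: temporal plaquettes based in the slice `t = 0`. [folklore] -/
def IsOCrossPlaq (p : Plaquette d L) : Prop := p.2.1.1 = 0 ∧ (p.1 0).val = 0

/-- Shared plaquettes: spatial plaquettes inside the site hyperplane. [folklore] -/
def IsOSharedPlaq (p : Plaquette d L) : Prop := p.2.1.1 ≠ 0 ∧ (p.1 0).val = L / 2 + 1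

/-- Negative plaquettes: the remaining ones. [folklore] -/
def IsONegPlaq (p : Plaquette d L) : Prop := ¬ IsOPosPlaq p ∧ ¬ IsOCrossPlaq p ∧ ¬ IsOSharedPlaq p

/-- `IsOPosEdge` is decidable. -/
instance : DecidablePred (IsOPosEdge (d := d) (L := L)) := fun _ => by
  unfold IsOPosEdge; infer_instance

/-- `IsOSharedEdge` is decidable. -/
instance : DecidablePred (IsOSharedEdge (d := d) (L := L)) := fun _ => by
  unfold IsOSharedEdge; infer_instance

/-- `IsOPosPlaq` is decidable. -/
instance : DecidablePred (IsOPosPlaq (d := d) (L := L)) := fun _ => by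
  unfold IsOPosPlaq; infer_instance

/-- `IsOCrossPlaq` is decidable. -/
instance : DecidablePred (IsOCrossPlaq (d := d) (L := L)) := fun _ => by
  unfold IsOCrossPlaq; infer_instance

/-- `IsOSharedPlaq` is decidable. -/
instance : DecidablePred (IsOSharedPlaq (d := d) (L := L)) := fun _ => by
  unfold IsOSharedPlaq; infer_instance

/-- `IsONegPlaq` is decidable. -/
instance : DecidablePred (IsONegPlaq (d := d) (L := L)) := fun _ => by
  unfold IsONegPlaq; infer_instance

variable [NeZero L] [Fact (1 < L)]

/-- The reflection of a positive or crossing link is not positive. [folklore] -/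
theorem not_isOPosEdge_edgeReflect (hL : Odd L) {e : Edge d L} (he : IsOPosEdge e ∨ IsLowerCross e) :
    ¬ IsOPosEdge (edgeReflect e) := by
  obtain ⟨x, i⟩ := e
  obtain ⟨m, hm⟩ := hL
  have hlt := ZMod.val_lt (x 0)
  unfold IsOPosEdge IsLowerCross at he
  unfold IsOPosEdge edgeReflect
  by_cases hi : i = 0
  · subst hi
    simp only [↓reduceIte, true_and] at he ⊢
    rw [val_timeReflect_shift_zero]
    split_ifs <;> omega
  · simp only [hi, ↓reduceIte, false_and, or_false] at he ⊢
    rw [val_timeReflect]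
    split_ifs <;> omega

omit [NeZero L] [Fact (1 < L)] in
/-- Crossing links are fixed by the reflection. [folklore] -/
theorem edgeReflect_of_isLowerCross {e : Edge d L} (he : IsLowerCross e) : edgeReflect e = e := by
  obtain ⟨x, i⟩ := e
  obtain ⟨hi, ht⟩ := he
  simp only at hi ht
  subst hi
  have h2 : x 0 + x 0 = 0 := by rw [(ZMod.val_eq_zero _).1 ht, add_zero]
  unfold edgeReflect
  simp only [↓reduceIte, timeReflect_shift_of_two_mul h2]

omit [Fact (1 < L)] in
/-- Shared links are fixed by the reflection. [folklore] -/
theorem edgeReflect_of_isOSharedEdge (hL : Odd L) {e : Edge d L} (he : IsOSharedEdge e) :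
    edgeReflect e = e := by
  obtain ⟨x, i⟩ := e
  obtain ⟨hi, ht⟩ := he
  simp only at hi ht
  unfold edgeReflect
  rw [if_neg hi, timeReflect_of_val_eq hL ht]

omit [NeZero L] [Fact (1 < L)] in
/-- Shared links are not positive. [folklore] -/
theorem not_isOPosEdge_of_isOSharedEdge {e : Edge d L} (he : IsOSharedEdge e) : ¬ IsOPosEdge e := by
  obtain ⟨-, ht⟩ := he
  unfold IsOPosEdge
  omega

omit [NeZero L] [Fact (1 < L)] in
/-- Crossing links are not positive. [folklore] -/
theorem not_isOPosEdge_of_isLowerCross {e : Edge d L} (he : IsLowerCross e) : ¬ IsOPosEdge e := by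
  obtain ⟨-, ht⟩ := he
  unfold IsOPosEdge
  omega

omit [NeZero L] [Fact (1 < L)] in
/-- Crossing links are not shared. [folklore] -/
theorem not_isOSharedEdge_of_isLowerCross {e : Edge d L} (he : IsLowerCross e) : ¬ IsOSharedEdge e :=
  fun h => h.1 he.1

omit [NeZero L] [Fact (1 < L)] in
/-- Crossing plaquettes are not positive. [folklore] -/
theorem not_isOPosPlaq_of_isOCrossPlaq {p : Plaquette d L} (hp : IsOCrossPlaq p) : ¬ IsOPosPlaq p := by
  obtain ⟨-, ht⟩ := hp
  unfold IsOPosPlaq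
  omega

omit [NeZero L] [Fact (1 < L)] in
/-- Shared plaquettes are neither positive nor crossing. [folklore] -/
theorem not_isOPosPlaq_of_isOSharedPlaq {p : Plaquette d L} (hp : IsOSharedPlaq p) :
    ¬ IsOPosPlaq p ∧ ¬ IsOCrossPlaq p := by
  obtain ⟨hi, ht⟩ := hp
  unfold IsOPosPlaq IsOCrossPlaq
  constructor
  · omega
  · exact fun h => hi h.1

/-- The reflection exchanges positive and negative plaquettes of the odd torus. [folklore] -/
theorem isONegPlaq_plaqReflect_iff (hL : Odd L) (p : Plaquette d L) :
    IsONegPlaq (plaqReflect p) ↔ IsOPosPlaq p := by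
  obtain ⟨x, ij⟩ := p
  obtain ⟨m, hm⟩ := hL
  have hlt := ZMod.val_lt (x 0)
  have h1L : 1 < L := Fact.out
  unfold IsONegPlaq IsOPosPlaq IsOCrossPlaq IsOSharedPlaq plaqReflect
  by_cases hi : ij.1.1 = 0
  · simp only [hi, ↓reduceIte, true_and, ne_eq, not_true_eq_false, false_and, not_false_eq_true,
      and_true]
    rw [val_timeReflect_shift_zero]
    split_ifs <;> (try simp) <;> omega
  · simp only [hi, ↓reduceIte, false_and, not_false_eq_true, true_and, ne_eq]
    rw [val_timeReflect]
    split_ifs <;> (try simp) <;> omega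

/-- The four links of a positive plaquette are positive or shared. [folklore] -/
theorem edges_of_isOPosPlaq (hL : Odd L) {p : Plaquette d L} (hp : IsOPosPlaq p) :
    (IsOPosEdge (p.1, p.2.1.1) ∨ IsOSharedEdge (p.1, p.2.1.1)) ∧
      (IsOPosEdge (p.1.shift p.2.1.1, p.2.1.2) ∨ IsOSharedEdge (p.1.shift p.2.1.1, p.2.1.2)) ∧
      (IsOPosEdge (p.1.shift p.2.1.2, p.2.1.1) ∨ IsOSharedEdge (p.1.shift p.2.1.2, p.2.1.1)) ∧
      (IsOPosEdge (p.1, p.2.1.2) ∨ IsOSharedEdge (p.1, p.2.1.2)) := by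
  obtain ⟨x, ⟨⟨i, j⟩, hij⟩⟩ := p
  obtain ⟨m, hm⟩ := hL
  have hj : j ≠ 0 := plaq_snd_ne_zero (x, ⟨(i, j), hij⟩)
  have hlt := ZMod.val_lt (x 0)
  have h1L : 1 < L := Fact.out
  unfold IsOPosPlaq at hp
  simp only at hp hj ⊢
  simp only [IsOPosEdge, IsOSharedEdge, ne_eq, hj, not_false_eq_true, true_and]
  by_cases hi : i = 0
  · subst hi
    simp only [not_true_eq_false, false_and, or_false]
    rw [val_shift_self, val_shift_of_ne _ (Ne.symm hj)]
    refine ⟨hp, ?_, hp, Or.inl hp⟩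
    split_ifs <;> omega
  · simp only [hi, not_false_eq_true, true_and]
    rw [val_shift_of_ne _ (Ne.symm hi), val_shift_of_ne _ (Ne.symm hj)]
    exact ⟨Or.inl hp, Or.inl hp, Or.inl hp, Or.inl hp⟩

omit [NeZero L] [Fact (1 < L)] in
/-- The four links of a shared plaquette are shared. [folklore] -/
theorem edges_of_isOSharedPlaq {p : Plaquette d L} (hp : IsOSharedPlaq p) :
    IsOSharedEdge (p.1, p.2.1.1) ∧ IsOSharedEdge (p.1.shift p.2.1.1, p.2.1.2) ∧
      IsOSharedEdge (p.1.shift p.2.1.2, p.2.1.1) ∧ IsOSharedEdge (p.1, p.2.1.2) := by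
  obtain ⟨x, ⟨⟨i, j⟩, hij⟩⟩ := p
  have hj : j ≠ 0 := plaq_snd_ne_zero (x, ⟨(i, j), hij⟩)
  obtain ⟨hi, ht⟩ := hp
  simp only at hi ht hj ⊢
  simp only [IsOSharedEdge, ne_eq, hi, hj, not_false_eq_true, true_and]
  rw [val_shift_of_ne _ (Ne.symm hi), val_shift_of_ne _ (Ne.symm hj)]
  exact ⟨ht, ht, ht, ht⟩

/-- The links of the half-plaquette `ω_p` of a crossing plaquette. [folklore] -/
theorem edges_of_isOCrossPlaq (hL : Odd L) {p : Plaquette d L} (hp : IsOCrossPlaq p) :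
    IsLowerCross (p.1, (0 : Fin d)) ∧ IsOPosEdge (p.1.shift 0, p.2.1.2) ∧
      IsLowerCross (p.1.shift p.2.1.2, (0 : Fin d)) := by
  obtain ⟨m, hm⟩ := hL
  have hj := plaq_snd_ne_zero p
  have h1L : 1 < L := Fact.out
  obtain ⟨-, ht⟩ := hp
  refine ⟨⟨rfl, ht⟩, ?_, ⟨rfl, ?_⟩⟩
  · unfold IsOPosEdge
    simp only
    rw [val_shift_self]
    split_ifs <;> omega
  · simp only
    rw [val_shift_of_ne _ (Ne.symm hj), ht]

end Classification

/-! ## The finsets `P`, `C`, `M` -/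

section Finsets

variable {d L : ℕ} [NeZero d] [NeZero L] [Fact (1 < L)]

/-- The finset `P` of positive links. [folklore] -/
def oPosEdges : Finset (Edge d L) := univ.filter IsOPosEdge

/-- The finset `C` of (lower) crossing links. [folklore] -/
def lowerEdges : Finset (Edge d L) := univ.filter IsLowerCross

/-- The finset `M` of shared links. [folklore] -/
def oSharedEdges : Finset (Edge d L) := univ.filter IsOSharedEdge

omit [Fact (1 < L)] in
/-- Membership in `P`. [folklore] -/
@[simp] theorem mem_oPosEdges {e : Edge d L} : e ∈ oPosEdges ↔ IsOPosEdge e := by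
  simp [oPosEdges]

omit [Fact (1 < L)] in
/-- Membership in `C`. [folklore] -/
@[simp] theorem mem_lowerEdges {e : Edge d L} : e ∈ lowerEdges ↔ IsLowerCross e := by
  simp [lowerEdges]

omit [Fact (1 < L)] in
/-- Membership in `M`. [folklore] -/
@[simp] theorem mem_oSharedEdges {e : Edge d L} : e ∈ oSharedEdges ↔ IsOSharedEdge e := by
  simp [oSharedEdges]

omit [Fact (1 < L)] in
/-- `M` and `P` are disjoint. [folklore] -/
theorem disjoint_oSharedEdges_oPosEdges : Disjoint (oSharedEdges : Finset (Edge d L)) oPosEdges := by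
  rw [Finset.disjoint_left]
  intro e he hp
  rw [mem_oSharedEdges] at he
  rw [mem_oPosEdges] at hp
  exact not_isOPosEdge_of_isOSharedEdge he hp

omit [Fact (1 < L)] in
/-- `M` and `C` are disjoint. [folklore] -/
theorem disjoint_oSharedEdges_lowerEdges : Disjoint (oSharedEdges : Finset (Edge d L)) lowerEdges := by
  rw [Finset.disjoint_left]
  intro e he hc
  rw [mem_oSharedEdges] at he
  rw [mem_lowerEdges] at hc
  exact not_isOSharedEdge_of_isLowerCross hc he

/-- The `P ∪ C`-coordinates of the reflected configuration depend only on the coordinates off `P`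
(hypothesis `hΘdep` of the abstract mechanism). [folklore] -/
theorem dependsOn_timeReflect_apply (hL : Odd L) {G : Type*} [Group G] (e : Edge d L)
    (he : e ∈ (oPosEdges ∪ lowerEdges : Finset (Edge d L))) :
    DependsOn (fun U : GaugeConfig d L G => U.timeReflect e)
      (((oPosEdgesᶜ : Finset (Edge d L)) : Set (Edge d L))) := by
  intro U V hUV
  have hmem : edgeReflect e ∈ ((oPosEdgesᶜ : Finset (Edge d L)) : Set (Edge d L)) := by
    rw [Finset.mem_coe, Finset.mem_compl, mem_oPosEdges]
    rw [Finset.mem_union, mem_oPosEdges, mem_lowerEdges] at he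
    exact not_isOPosEdge_edgeReflect hL he
  simp only [timeReflect_apply, hUV _ hmem]

omit [Fact (1 < L)] in
/-- The reflection fixes the shared coordinates (hypothesis `hΘM`). [folklore] -/
theorem timeReflect_apply_of_mem_oSharedEdges (hL : Odd L) {G : Type*} [Group G]
    (U : GaugeConfig d L G) (e : Edge d L) (he : e ∈ (oSharedEdges : Finset (Edge d L))) :
    U.timeReflect e = U e := by
  rw [mem_oSharedEdges] at he
  rw [timeReflect_apply, if_neg he.1, edgeReflect_of_isOSharedEdge hL he]

end Finsets

/-! ## The Wilson action split into positive, negative, crossing and shared parts -/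

section Action

variable {d L N : ℕ} [NeZero d] [NeZero L] [Fact (1 < L)]
variable {G : Type*} [Group G] [TopologicalSpace G] [IsTopologicalGroup G] [CompactSpace G]
  [MeasurableSpace G] [BorelSpace G]
variable (ρ : G →* Matrix (Fin N) (Fin N) ℂ)

/-- The positive part `A(U)` of the action. [folklore] -/
def oPosAction (U : GaugeConfig d L G) : ℝ := ∑ p ∈ univ.filter IsOPosPlaq, plaqRe ρ U p

/-- The crossing part `X(U)` of the action. [folklore] -/
def oCrossAction (U : GaugeConfig d L G) : ℝ := ∑ p ∈ univ.filter IsOCrossPlaq, plaqRe ρ U p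

/-- The shared part `S_M(U)` of the action. [folklore] -/
def oSharedAction (U : GaugeConfig d L G) : ℝ := ∑ p ∈ univ.filter IsOSharedPlaq, plaqRe ρ U p

omit [MeasurableSpace G] [BorelSpace G] in
/-- The negative part of the action is the positive part of the reflected configuration. [folklore] -/
theorem sum_neg_eq_oPosAction_timeReflect (hL : Odd L) (hρ : Continuous ρ) (U : GaugeConfig d L G) :
    ∑ p ∈ univ.filter IsONegPlaq, plaqRe ρ U p = oPosAction ρ U.timeReflect := by
  unfold oPosAction
  simp_rw [plaqRe_timeReflect ρ hρ]
  symm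
  refine Finset.sum_equiv plaqReflectEquiv (fun p => ?_) (fun p _ => rfl)
  simp only [Finset.mem_filter, Finset.mem_univ, true_and]
  exact (isONegPlaq_plaqReflect_iff hL p).symm

omit [MeasurableSpace G] [BorelSpace G] in
/-- `∑ₚ Re tr ρ(U_p) = A(U) + A(ΘU) + X(U) + S_M(U)` on the odd torus. [folklore] -/
theorem sum_plaqRe_eq_odd (hL : Odd L) (hρ : Continuous ρ) (U : GaugeConfig d L G) :
    ∑ p, plaqRe ρ U p =
      oPosAction ρ U + oPosAction ρ U.timeReflect + oCrossAction ρ U + oSharedAction ρ U := by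
  have h1 : ∑ p, plaqRe ρ U p = ∑ p ∈ univ.filter IsOPosPlaq, plaqRe ρ U p +
      ∑ p ∈ univ.filter (fun p => ¬ IsOPosPlaq p), plaqRe ρ U p :=
    (Finset.sum_filter_add_sum_filter_not univ IsOPosPlaq _).symm
  have h2 : ∑ p ∈ univ.filter (fun p => ¬ IsOPosPlaq p), plaqRe ρ U p =
      ∑ p ∈ univ.filter IsOCrossPlaq, plaqRe ρ U p +
        ∑ p ∈ univ.filter (fun p => ¬ IsOPosPlaq p ∧ ¬ IsOCrossPlaq p), plaqRe ρ U p := by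
    rw [← Finset.sum_filter_add_sum_filter_not (univ.filter fun p => ¬ IsOPosPlaq p) IsOCrossPlaq,
      Finset.filter_filter, Finset.filter_filter]
    have hC : (univ.filter fun p : Plaquette d L => ¬ IsOPosPlaq p ∧ IsOCrossPlaq p) =
        univ.filter IsOCrossPlaq :=
      Finset.filter_congr fun p _ => ⟨fun h => h.2, fun h => ⟨not_isOPosPlaq_of_isOCrossPlaq h, h⟩⟩
    rw [hC]
  have h3 : ∑ p ∈ univ.filter (fun p => ¬ IsOPosPlaq p ∧ ¬ IsOCrossPlaq p), plaqRe ρ U p =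
      ∑ p ∈ univ.filter IsOSharedPlaq, plaqRe ρ U p + ∑ p ∈ univ.filter IsONegPlaq, plaqRe ρ U p := by
    rw [← Finset.sum_filter_add_sum_filter_not
        (univ.filter fun p => ¬ IsOPosPlaq p ∧ ¬ IsOCrossPlaq p) IsOSharedPlaq,
      Finset.filter_filter, Finset.filter_filter]
    have hS : (univ.filter fun p : Plaquette d L => (¬ IsOPosPlaq p ∧ ¬ IsOCrossPlaq p) ∧ IsOSharedPlaq p) =
        univ.filter IsOSharedPlaq :=
      Finset.filter_congr fun p _ => ⟨fun h => h.2, fun h => ⟨not_isOPosPlaq_of_isOSharedPlaq h, h⟩⟩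
    have hN : (univ.filter fun p : Plaquette d L =>
        (¬ IsOPosPlaq p ∧ ¬ IsOCrossPlaq p) ∧ ¬ IsOSharedPlaq p) = univ.filter IsONegPlaq :=
      Finset.filter_congr fun p _ => by unfold IsONegPlaq; tauto
    rw [hS, hN]
  rw [h1, h2, h3, sum_neg_eq_oPosAction_timeReflect ρ hL hρ]
  unfold oPosAction oCrossAction oSharedAction
  ring

omit [MeasurableSpace G] [BorelSpace G] in
/-- `S = N·#plaquettes - A - A ∘ Θ - X - S_M` on the odd torus. [folklore] -/
theorem wilsonAction_oddSplit (hL : Odd L) (hρ : Continuous ρ) (U : GaugeConfig d L G) :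
    wilsonAction ρ U = N * Fintype.card (Plaquette d L) -
      (oPosAction ρ U + oPosAction ρ U.timeReflect + oCrossAction ρ U + oSharedAction ρ U) := by
  rw [wilsonAction_eq, sum_plaqRe_eq_odd ρ hL hρ]

omit [TopologicalSpace G] [IsTopologicalGroup G] [CompactSpace G] [MeasurableSpace G]
  [BorelSpace G] in
/-- The positive part of the action depends only on the links in `P ∪ M` (stated for
`P ∪ C ∪ M`). [folklore] -/
theorem dependsOn_oPosAction (hL : Odd L) :
    DependsOn (oPosAction (d := d) (L := L) ρ)
      ((oPosEdges ∪ lowerEdges ∪ oSharedEdges : Finset (Edge d L)) : Set (Edge d L)) := by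
  intro U V hUV
  unfold oPosAction
  refine Finset.sum_congr rfl fun p hp => ?_
  rw [Finset.mem_filter] at hp
  obtain ⟨h1, h2, h3, h4⟩ := edges_of_isOPosPlaq hL hp.2
  have h : ∀ e, IsOPosEdge e ∨ IsOSharedEdge e → U e = V e := fun e he => hUV e (by
    rcases he with he | he <;> simp [he])
  simp only [plaqRe, plaquetteHolonomy, h _ h1, h _ h2, h _ h3, h _ h4]

omit [Fact (1 < L)] [TopologicalSpace G] [IsTopologicalGroup G] [CompactSpace G] [MeasurableSpace G]
  [BorelSpace G] in
/-- The shared part of the action depends only on the links in `M`. [folklore] -/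
theorem dependsOn_oSharedAction :
    DependsOn (oSharedAction (d := d) (L := L) ρ)
      ((oSharedEdges : Finset (Edge d L)) : Set (Edge d L)) := by
  intro U V hUV
  unfold oSharedAction
  refine Finset.sum_congr rfl fun p hp => ?_
  rw [Finset.mem_filter] at hp
  obtain ⟨h1, h2, h3, h4⟩ := edges_of_isOSharedPlaq hp.2
  have h : ∀ e, IsOSharedEdge e → U e = V e := fun e he => hUV e (by simp [he])
  simp only [plaqRe, plaquetteHolonomy, h _ h1, h _ h2, h _ h3, h _ h4]

omit [Fact (1 < L)] [TopologicalSpace G] [IsTopologicalGroup G] [CompactSpace G] [MeasurableSpace G]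
  [BorelSpace G] in
/-- The shared part of the action is reflection invariant. [folklore] -/
theorem oSharedAction_timeReflect (hL : Odd L) (U : GaugeConfig d L G) :
    oSharedAction ρ U.timeReflect = oSharedAction ρ U :=
  dependsOn_oSharedAction ρ fun e he =>
    timeReflect_apply_of_mem_oSharedEdges hL U e (Finset.mem_coe.1 he)

omit [NeZero d] [Fact (1 < L)] [MeasurableSpace G] [BorelSpace G] in
/-- A filtered sum of plaquette functions is bounded by `N · #plaquettes`. [folklore] -/
theorem abs_sum_filter_plaqRe_le (hρ : Continuous ρ) (q : Plaquette d L → Prop) [DecidablePred q]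
    (U : GaugeConfig d L G) :
    |∑ p ∈ univ.filter q, plaqRe ρ U p| ≤ N * Fintype.card (Plaquette d L) := by
  calc |∑ p ∈ univ.filter q, plaqRe ρ U p| ≤ ∑ p ∈ univ.filter q, |plaqRe ρ U p| :=
        Finset.abs_sum_le_sum_abs _ _
    _ ≤ ∑ _p ∈ univ.filter q, (N : ℝ) := Finset.sum_le_sum fun p _ => abs_plaqRe_le ρ hρ U p
    _ ≤ ∑ _p : Plaquette d L, (N : ℝ) :=
        Finset.sum_le_sum_of_subset_of_nonneg (Finset.filter_subset _ _) fun _ _ _ => Nat.cast_nonneg _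
    _ = N * Fintype.card (Plaquette d L) := by
        rw [Finset.sum_const, Finset.card_univ, nsmul_eq_mul, mul_comm]

omit [NeZero d] [Fact (1 < L)] [CompactSpace G] in
/-- A filtered sum of plaquette functions is measurable. [folklore] -/
theorem measurable_sum_filter_plaqRe (hρ : Continuous ρ) (q : Plaquette d L → Prop)
    [DecidablePred q] :
    Measurable fun U : GaugeConfig d L G => ∑ p ∈ univ.filter q, plaqRe ρ U p :=
  Finset.measurable_sum _ fun p _ => measurable_plaqRe ρ hρ p

end Action

/-! ## Splitting the lower crossing links -/

section Crossing

variable {d L N : ℕ} [NeZero d] [NeZero L] [Fact (1 < L)]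
variable {G : Type*} [Group G] [TopologicalSpace G] [IsTopologicalGroup G] [CompactSpace G]
  [MeasurableSpace G] [BorelSpace G]
variable (ρ : G →* Matrix (Fin N) (Fin N) ℂ)

/-- The substitution splitting the crossing links of the odd torus: `U_e ↦ U_e Y_e` on the
temporal links `t = 0 → 1` only. [folklore] -/
def translateLow (Y U : GaugeConfig d L G) : GaugeConfig d L G := fun e =>
  U e * (if IsLowerCross e then Y e else 1)

omit [NeZero L] [Fact (1 < L)] [TopologicalSpace G] [IsTopologicalGroup G] [CompactSpace G]
  [MeasurableSpace G] [BorelSpace G] in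
/-- `translateLow` on a crossing link. [folklore] -/
theorem translateLow_apply_of_isLowerCross (Y U : GaugeConfig d L G) {e : Edge d L}
    (he : IsLowerCross e) : translateLow Y U e = U e * Y e := by
  simp only [translateLow, if_pos he]

omit [NeZero L] [Fact (1 < L)] [TopologicalSpace G] [IsTopologicalGroup G] [CompactSpace G]
  [MeasurableSpace G] [BorelSpace G] in
/-- `translateLow` does not change non-crossing links. [folklore] -/
theorem translateLow_apply_of_not_isLowerCross (Y U : GaugeConfig d L G) {e : Edge d L}
    (he : ¬ IsLowerCross e) : translateLow Y U e = U e := by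
  simp only [translateLow, if_neg he, mul_one]

omit [Fact (1 < L)] [Group G] [TopologicalSpace G] [IsTopologicalGroup G] [CompactSpace G]
  [MeasurableSpace G] [BorelSpace G] in
/-- The spliced configuration equals `Y` on crossing links. [folklore] -/
theorem splice_apply_of_isLowerCross (U Y : GaugeConfig d L G) {e : Edge d L} (he : IsLowerCross e) :
    LatticeRP.splice lowerEdges (U, Y) e = Y e := by
  simp [LatticeRP.splice, he]

omit [Fact (1 < L)] [Group G] [TopologicalSpace G] [IsTopologicalGroup G] [CompactSpace G]
  [MeasurableSpace G] [BorelSpace G] in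
/-- The spliced configuration equals `U` off the crossing links. [folklore] -/
theorem splice_apply_of_not_isLowerCross (U Y : GaugeConfig d L G) {e : Edge d L}
    (he : ¬ IsLowerCross e) : LatticeRP.splice lowerEdges (U, Y) e = U e := by
  simp [LatticeRP.splice, he]

omit [MeasurableSpace G] [BorelSpace G] in
/-- **The crossing identity** for the odd torus: for a crossing plaquette `p`,
`Re tr ρ((translateLow Y U)_p) = ∑_{k,l} Re (σ(ω_p(z))_{kl} conj σ(ω_p(ΘU))_{kl})`,
`z = splice_C(U, Y)`. [folklore] -/
theorem plaqRe_translateLow_of_isOCrossPlaq (hL : Odd L) (hρ : Continuous ρ) (U Y : GaugeConfig d L G)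
    {p : Plaquette d L} (hp : IsOCrossPlaq p) :
    plaqRe ρ (translateLow Y U) p = ∑ k, ∑ l,
      (CompactGroup.unitarize ρ hρ (halfPlaq p (LatticeRP.splice lowerEdges (U, Y))) k l *
        (starRingEnd ℂ) (CompactGroup.unitarize ρ hρ (halfPlaq p U.timeReflect) k l)).re := by
  obtain ⟨hc1, hp2, hc3⟩ := edges_of_isOCrossPlaq hL hp
  obtain ⟨x, ⟨⟨i, j⟩, hij⟩⟩ := p
  obtain ⟨hi, ht⟩ := hp
  simp only at hi ht hc1 hp2 hc3
  subst hi
  have hj : j ≠ 0 := plaq_snd_ne_zero (x, ⟨(0, j), hij⟩)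
  have h2 : x 0 + x 0 = 0 := by rw [(ZMod.val_eq_zero _).1 ht, add_zero]
  have h2j : (x.shift j) 0 + (x.shift j) 0 = 0 := by rw [shift_apply_of_ne _ (Ne.symm hj)]; exact h2
  have hΘ1 : U.timeReflect (x, 0) = (U (x, 0))⁻¹ := by
    rw [timeReflect_apply]
    simp only [edgeReflect, ↓reduceIte, timeReflect_shift_of_two_mul h2]
  have hΘ2 : U.timeReflect (x.shift 0, j) = U (x, j) := by
    rw [timeReflect_apply]
    simp only [edgeReflect, hj, ↓reduceIte, timeReflect_shift_of_two_mul h2]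
  have hΘ3 : U.timeReflect (x.shift j, 0) = (U (x.shift j, 0))⁻¹ := by
    rw [timeReflect_apply]
    simp only [edgeReflect, ↓reduceIte, timeReflect_shift_of_two_mul h2j]
  have hn2 : ¬ IsLowerCross ((x.shift 0, j) : Edge d L) := fun h => hj h.1
  have hn4 : ¬ IsLowerCross ((x, j) : Edge d L) := fun h => hj h.1
  unfold plaqRe plaquetteHolonomy halfPlaq
  simp only
  rw [if_pos ht, if_pos ht, translateLow_apply_of_isLowerCross Y U hc1,
    translateLow_apply_of_not_isLowerCross Y U hn2, translateLow_apply_of_isLowerCross Y U hc3,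
    translateLow_apply_of_not_isLowerCross Y U hn4, splice_apply_of_isLowerCross U Y hc1,
    splice_apply_of_not_isLowerCross U Y hn2, splice_apply_of_isLowerCross U Y hc3, hΘ1, hΘ2, hΘ3]
  rw [show U (x, 0) * Y (x, 0) * U (x.shift 0, j) * (U (x.shift j, 0) * Y (x.shift j, 0))⁻¹ *
        (U (x, j))⁻¹ = U (x, 0) * ((Y (x, 0) * U (x.shift 0, j) * (Y (x.shift j, 0))⁻¹) *
        ((U (x, 0))⁻¹ * U (x, j) * ((U (x.shift j, 0))⁻¹)⁻¹)⁻¹) * (U (x, 0))⁻¹ by group,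
    CompactGroup.trace_conj_eq, CompactGroup.re_trace_mul_inv_eq_sum ρ hρ]

/-- The coefficient functions `aᵢ` of the odd torus (crossing plaquettes at `t = 0` only). [folklore] -/
def oCoeff (hρ : Continuous ρ) (β : ℝ) (i : CoeffIndex d L N) (V : GaugeConfig d L G) : ℂ :=
  if IsOCrossPlaq i.1 then
    (Real.sqrt (β / 2) : ℂ) *
      (if i.2.2.2 then CompactGroup.unitarize ρ hρ (halfPlaq i.1 V) i.2.1 i.2.2.1
        else (starRingEnd ℂ) (CompactGroup.unitarize ρ hρ (halfPlaq i.1 V) i.2.1 i.2.2.1))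
  else 0

omit [MeasurableSpace G] [BorelSpace G] in
/-- **The crossing Boltzmann weight is a Gram kernel**:
`∑ᵢ aᵢ(z) conj aᵢ(ΘU) = β X(translateLow Y U)`. [folklore] -/
theorem sum_oCoeff_mul_conj (hL : Odd L) (hρ : Continuous ρ) {β : ℝ} (hβ : 0 ≤ β)
    (U Y : GaugeConfig d L G) :
    ∑ i, oCoeff ρ hρ β i (LatticeRP.splice lowerEdges (U, Y)) *
        (starRingEnd ℂ) (oCoeff ρ hρ β i U.timeReflect) =
      ((β * oCrossAction ρ (translateLow Y U) : ℝ) : ℂ) := by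
  have hs : (Real.sqrt (β / 2) : ℂ) * (Real.sqrt (β / 2) : ℂ) = ((β / 2 : ℝ) : ℂ) := by
    rw [← Complex.ofReal_mul, Real.mul_self_sqrt (by linarith)]
  unfold oCrossAction
  rw [Finset.mul_sum, Complex.ofReal_sum, Finset.sum_filter, Fintype.sum_prod_type]
  refine Finset.sum_congr rfl fun p _ => ?_
  by_cases hp : IsOCrossPlaq p
  · rw [if_pos hp, plaqRe_translateLow_of_isOCrossPlaq ρ hL hρ U Y hp, Finset.mul_sum, Complex.ofReal_sum,
      Fintype.sum_prod_type]
    refine Finset.sum_congr rfl fun k _ => ?_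
    rw [Finset.mul_sum, Complex.ofReal_sum, Fintype.sum_prod_type]
    refine Finset.sum_congr rfl fun l _ => ?_
    rw [Fintype.sum_bool]
    simp only [oCoeff, if_pos hp, ↓reduceIte, Bool.false_eq_true, map_mul, Complex.conj_ofReal,
      Complex.conj_conj]
    set u := CompactGroup.unitarize ρ hρ (halfPlaq p (LatticeRP.splice lowerEdges (U, Y))) k l
    set v := CompactGroup.unitarize ρ hρ (halfPlaq p U.timeReflect) k l
    calc (Real.sqrt (β / 2) : ℂ) * u * ((Real.sqrt (β / 2) : ℂ) * (starRingEnd ℂ) v) +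
          (Real.sqrt (β / 2) : ℂ) * (starRingEnd ℂ) u * ((Real.sqrt (β / 2) : ℂ) * v)
        = ((Real.sqrt (β / 2) : ℂ) * (Real.sqrt (β / 2) : ℂ)) *
            (u * (starRingEnd ℂ) v + (starRingEnd ℂ) (u * (starRingEnd ℂ) v)) := by
          simp only [map_mul, Complex.conj_conj]; ring
      _ = ((β * (u * (starRingEnd ℂ) v).re : ℝ) : ℂ) := by
          rw [hs, Complex.add_conj]; push_cast; ring
  · simp [oCoeff, hp]

omit [NeZero L] [Fact (1 < L)] in
/-- The coefficient functions are measurable. [folklore] -/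
theorem measurable_oCoeff (hρ : Continuous ρ) (β : ℝ) (i : CoeffIndex d L N) :
    Measurable (oCoeff ρ hρ β i : GaugeConfig d L G → ℂ) := by
  unfold oCoeff
  by_cases hp : IsOCrossPlaq i.1
  · simp only [if_pos hp]
    have hω := entryMeasurable_halfPlaq ρ hρ i.1 (G := G)
    by_cases hs : i.2.2.2 = true
    · simp only [hs, ↓reduceIte]
      exact (hω _ _).const_mul _
    · simp only [hs, Bool.false_eq_true, ↓reduceIte]
      exact (Complex.continuous_conj.measurable.comp (hω _ _)).const_mul _
  · simp only [if_neg hp]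
    exact measurable_const

omit [NeZero L] [Fact (1 < L)] [MeasurableSpace G] [BorelSpace G] in
/-- The coefficient functions are bounded by `√(β/2)`. [folklore] -/
theorem norm_oCoeff_le (hρ : Continuous ρ) (β : ℝ) (i : CoeffIndex d L N) (V : GaugeConfig d L G) :
    ‖oCoeff ρ hρ β i V‖ ≤ Real.sqrt (β / 2) := by
  unfold oCoeff
  split_ifs with hp hs
  · rw [norm_mul, Complex.norm_real, Real.norm_eq_abs, abs_of_nonneg (Real.sqrt_nonneg _)]
    exact mul_le_of_le_one_right (Real.sqrt_nonneg _)
      (CompactGroup.norm_unitarize_apply_le_one ρ hρ _ _ _)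
  · rw [norm_mul, Complex.norm_real, Real.norm_eq_abs, abs_of_nonneg (Real.sqrt_nonneg _),
      Complex.norm_conj]
    exact mul_le_of_le_one_right (Real.sqrt_nonneg _)
      (CompactGroup.norm_unitarize_apply_le_one ρ hρ _ _ _)
  · rw [norm_zero]
    exact Real.sqrt_nonneg _

omit [TopologicalSpace G] [IsTopologicalGroup G] [CompactSpace G] [MeasurableSpace G]
  [BorelSpace G] in
/-- The half plaquette of a crossing plaquette depends only on links in `P ∪ C`. [folklore] -/
theorem halfPlaq_congr_odd (hL : Odd L) {p : Plaquette d L} (hp : IsOCrossPlaq p)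
    {U V : GaugeConfig d L G}
    (hUV : ∀ e ∈ ((oPosEdges ∪ lowerEdges ∪ oSharedEdges : Finset (Edge d L)) : Set (Edge d L)),
      U e = V e) :
    halfPlaq p U = halfPlaq p V := by
  have hP : ∀ e, IsOPosEdge e → U e = V e := fun e he => hUV e (by simp [he])
  have hC : ∀ e, IsLowerCross e → U e = V e := fun e he => hUV e (by simp [he])
  obtain ⟨hc1, hp2, hc3⟩ := edges_of_isOCrossPlaq hL hp
  obtain ⟨-, ht⟩ := hp
  unfold halfPlaq
  rw [if_pos ht, if_pos ht, hC _ hc1, hP _ hp2, hC _ hc3]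

omit [MeasurableSpace G] [BorelSpace G] in
/-- The coefficient functions depend only on the links in `P ∪ C ∪ M`. [folklore] -/
theorem dependsOn_oCoeff (hL : Odd L) (hρ : Continuous ρ) (β : ℝ) (i : CoeffIndex d L N) :
    DependsOn (oCoeff ρ hρ β i : GaugeConfig d L G → ℂ)
      ((oPosEdges ∪ lowerEdges ∪ oSharedEdges : Finset (Edge d L)) : Set (Edge d L)) := by
  intro U V hUV
  unfold oCoeff
  by_cases hp : IsOCrossPlaq i.1
  · simp only [if_pos hp, halfPlaq_congr_odd hL hp hUV]
  · simp only [if_neg hp]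

end Crossing

/-! ## Measure preservation and the observable `g e^{βA} e^{βS_M/2}` -/

section Measure

variable {d L N : ℕ} [NeZero d] [NeZero L] [Fact (1 < L)]
variable {G : Type*} [Group G] [TopologicalSpace G] [IsTopologicalGroup G] [CompactSpace G]
  [MeasurableSpace G] [BorelSpace G]
variable (ρ : G →* Matrix (Fin N) (Fin N) ℂ)

omit [Fact (1 < L)] in
/-- **`translateLow Y` preserves the product Haar measure** (right invariance of Haar measure on
the compact group). [folklore] -/
theorem measurePreserving_translateLow (Y : GaugeConfig d L G) :
    MeasurePreserving (translateLow Y)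
      (LatticeRP.piMeasure (haarProbability G)) (LatticeRP.piMeasure (haarProbability G)) := by
  show MeasurePreserving (fun (U : GaugeConfig d L G) (e : Edge d L) =>
    (fun g : G => g * (if IsLowerCross e then Y e else 1)) (U e))
      (LatticeRP.piMeasure (haarProbability G)) (LatticeRP.piMeasure (haarProbability G))
  exact measurePreserving_pi _ _ fun e => measurePreserving_mul_right (haarProbability G) _

/-- The observable `g · exp(β A) · exp(β S_M / 2)`. [folklore] -/
def oObs (β : ℝ) (g : GaugeConfig d L G → ℂ) (V : GaugeConfig d L G) : ℂ :=
  g V * (Real.exp (β * oPosAction ρ V + β / 2 * oSharedAction ρ V) : ℂ)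

omit [Fact (1 < L)] [CompactSpace G] in
/-- `oObs` is measurable. [folklore] -/
theorem measurable_oObs (hρ : Continuous ρ) (β : ℝ) {g : GaugeConfig d L G → ℂ}
    (hg : Measurable g) : Measurable (oObs ρ β g) :=
  hg.mul (Complex.measurable_ofReal.comp
    (((measurable_sum_filter_plaqRe ρ hρ _).const_mul β).add
      ((measurable_sum_filter_plaqRe ρ hρ _).const_mul (β / 2))).exp)

omit [Fact (1 < L)] [MeasurableSpace G] [BorelSpace G] in
/-- `oObs` is bounded. [folklore] -/
theorem norm_oObs_le (hρ : Continuous ρ) (β : ℝ) {g : GaugeConfig d L G → ℂ}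
    {Kg : ℝ} (hgb : ∀ U, ‖g U‖ ≤ Kg) (V : GaugeConfig d L G) :
    ‖oObs ρ β g V‖ ≤ |Kg| * Real.exp ((|β| + |β / 2|) * (N * Fintype.card (Plaquette d L))) := by
  rw [oObs, norm_mul, Complex.norm_real, Real.norm_eq_abs, abs_of_pos (Real.exp_pos _)]
  refine mul_le_mul ((hgb V).trans (le_abs_self _)) ?_ (Real.exp_pos _).le (abs_nonneg _)
  refine Real.exp_le_exp.2 ?_
  rw [add_mul]
  refine add_le_add ?_ ?_
  · calc β * oPosAction ρ V ≤ |β * oPosAction ρ V| := le_abs_self _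
      _ = |β| * |oPosAction ρ V| := abs_mul _ _
      _ ≤ |β| * (N * Fintype.card (Plaquette d L)) :=
          mul_le_mul_of_nonneg_left (abs_sum_filter_plaqRe_le ρ hρ _ V) (abs_nonneg _)
  · calc β / 2 * oSharedAction ρ V ≤ |β / 2 * oSharedAction ρ V| := le_abs_self _
      _ = |β / 2| * |oSharedAction ρ V| := abs_mul _ _
      _ ≤ |β / 2| * (N * Fintype.card (Plaquette d L)) :=
          mul_le_mul_of_nonneg_left (abs_sum_filter_plaqRe_le ρ hρ _ V) (abs_nonneg _)

omit [TopologicalSpace G] [IsTopologicalGroup G] [CompactSpace G] [MeasurableSpace G]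
  [BorelSpace G] in
/-- `oObs` depends only on the links in `P ∪ C ∪ M` if `g` does. [folklore] -/
theorem dependsOn_oObs (hL : Odd L) (β : ℝ) {g : GaugeConfig d L G → ℂ}
    (hgdep : DependsOn g ((oPosEdges ∪ lowerEdges ∪ oSharedEdges : Finset (Edge d L)) : Set (Edge d L))) :
    DependsOn (oObs ρ β g)
      ((oPosEdges ∪ lowerEdges ∪ oSharedEdges : Finset (Edge d L)) : Set (Edge d L)) := by
  intro U V hUV
  have hM : ∀ e ∈ ((oSharedEdges : Finset (Edge d L)) : Set (Edge d L)), U e = V e := fun e he =>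
    hUV e (by rw [Finset.coe_union]; exact Or.inr he)
  simp only [oObs, hgdep hUV, dependsOn_oPosAction ρ hL hUV, dependsOn_oSharedAction ρ hM]

end Measure

/-! ## Assembly -/

section Assembly

variable {d L N : ℕ} [NeZero d] [NeZero L] [Fact (1 < L)]
variable {G : Type*} [Group G] [TopologicalSpace G] [IsTopologicalGroup G] [CompactSpace G]
  [MeasurableSpace G] [BorelSpace G]
variable (ρ : G →* Matrix (Fin N) (Fin N) ℂ)

/-- The doubled integrand for one covariant component `g`. [folklore] -/
def oIntegrand₂ (hρ : Continuous ρ) (β : ℝ) (g : GaugeConfig d L G → ℂ)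
    (p : GaugeConfig d L G × GaugeConfig d L G) : ℂ :=
  (Real.exp (-β * (N * Fintype.card (Plaquette d L))) : ℂ) *
    (oObs ρ β g (LatticeRP.splice lowerEdges p) * (starRingEnd ℂ) (oObs ρ β g p.1.timeReflect) *
      Complex.exp (∑ i, oCoeff ρ hρ β i (LatticeRP.splice lowerEdges p) *
        (starRingEnd ℂ) (oCoeff ρ hρ β i p.1.timeReflect)))

omit [MeasurableSpace G] [BorelSpace G] in
/-- **The pointwise identity** after the substitution `translateLow Y`: for a covariant
observable, `e^{-β S(U')} Φ(U') = ∑ₖ e^{-βN#plaq} (gₖ e^{βA+βS_M/2})(z) conj (…)(ΘU) exp(∑ᵢ aᵢ(z) conj aᵢ(ΘU))`,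
`U' = translateLow Y U`, `z = splice_C(U, Y)`. [folklore] -/
theorem oIntegrand_translateLow (hL : Odd L) (hρ : Continuous ρ) {β : ℝ} (hβ : 0 ≤ β)
    {K : Type*} [Fintype K] {g : K → GaugeConfig d L G → ℂ} {Φ : GaugeConfig d L G → ℂ}
    (hcov : ∀ U Y, Φ (translateLow Y U) =
      ∑ k, g k (LatticeRP.splice lowerEdges (U, Y)) * conj (g k U.timeReflect))
    (U Y : GaugeConfig d L G) :
    (Real.exp (-β * wilsonAction ρ (translateLow Y U)) : ℂ) * Φ (translateLow Y U) =
      ∑ k, oIntegrand₂ ρ hρ β (g k) (U, Y) := by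
  -- `translateLow`, the splice and `Θ ∘ translateLow` agree with `U`, `U`, `Θ U` on `P ∪ M`
  have hPM : ∀ e : Edge d L, IsOPosEdge e ∨ IsOSharedEdge e → ¬ IsLowerCross e := fun e he hc => by
    rcases he with he | he
    · exact not_isOPosEdge_of_isLowerCross hc he
    · exact not_isOSharedEdge_of_isLowerCross hc he
  have hmemP : ∀ e : Edge d L,
      e ∈ ((oPosEdges ∪ lowerEdges ∪ oSharedEdges : Finset (Edge d L)) : Set (Edge d L)) →
      IsOPosEdge e ∨ IsLowerCross e ∨ IsOSharedEdge e := fun e he => by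
    simpa [or_assoc] using he
  -- positive action
  have hA : ∀ V W : GaugeConfig d L G, (∀ e, IsOPosEdge e ∨ IsOSharedEdge e → V e = W e) →
      oPosAction ρ V = oPosAction ρ W := by
    intro V W h
    unfold oPosAction
    refine Finset.sum_congr rfl fun p hp => ?_
    rw [Finset.mem_filter] at hp
    obtain ⟨h1, h2, h3, h4⟩ := edges_of_isOPosPlaq hL hp.2
    simp only [plaqRe, plaquetteHolonomy, h _ h1, h _ h2, h _ h3, h _ h4]
  have hM : ∀ V W : GaugeConfig d L G, (∀ e, IsOSharedEdge e → V e = W e) →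
      oSharedAction ρ V = oSharedAction ρ W := fun V W h =>
    dependsOn_oSharedAction ρ fun e he => h e (by simpa using he)
  have htr : ∀ e, IsOPosEdge e ∨ IsOSharedEdge e → translateLow Y U e = U e := fun e he =>
    translateLow_apply_of_not_isLowerCross Y U (hPM e he)
  have hsp : ∀ e, IsOPosEdge e ∨ IsOSharedEdge e → LatticeRP.splice lowerEdges (U, Y) e = U e :=
    fun e he => splice_apply_of_not_isLowerCross U Y (hPM e he)
  have hΘtr : ∀ e, IsOPosEdge e ∨ IsOSharedEdge e →
      (translateLow Y U).timeReflect e = U.timeReflect e := by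
    intro e he
    have hne : ¬ IsLowerCross (edgeReflect e) := by
      intro hc
      have := edgeReflect_of_isLowerCross (d := d) (L := L) hc
      rw [edgeReflect_edgeReflect] at this
      rw [this] at he
      exact hPM _ he hc
    rw [timeReflect_apply, timeReflect_apply, translateLow_apply_of_not_isLowerCross Y U hne]
  have hA1 : oPosAction ρ (translateLow Y U) = oPosAction ρ U := hA _ _ htr
  have hA2 : oPosAction ρ (translateLow Y U).timeReflect = oPosAction ρ U.timeReflect := hA _ _ hΘtr
  have hA3 : oPosAction ρ (LatticeRP.splice lowerEdges (U, Y)) = oPosAction ρ U := hA _ _ hsp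
  have hM1 : oSharedAction ρ (translateLow Y U) = oSharedAction ρ U :=
    hM _ _ fun e he => htr e (Or.inr he)
  have hM2 : oSharedAction ρ (LatticeRP.splice lowerEdges (U, Y)) = oSharedAction ρ U :=
    hM _ _ fun e he => hsp e (Or.inr he)
  have hM3 : oSharedAction ρ U.timeReflect = oSharedAction ρ U := oSharedAction_timeReflect ρ hL U
  rw [hcov, wilsonAction_oddSplit ρ hL hρ, hA1, hA2, hM1, Finset.mul_sum]
  refine Finset.sum_congr rfl fun k _ => ?_
  unfold oIntegrand₂ oObs
  rw [sum_oCoeff_mul_conj ρ hL hρ hβ, hA3, hM2, hM3, ← Complex.ofReal_exp]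
  simp only [map_mul, Complex.conj_ofReal]
  rw [show -β * (↑N * ↑(Fintype.card (Plaquette d L)) -
        (oPosAction ρ U + oPosAction ρ U.timeReflect + oCrossAction ρ (translateLow Y U) +
          oSharedAction ρ U)) =
      -β * (↑N * ↑(Fintype.card (Plaquette d L))) +
        (β * oPosAction ρ U + β / 2 * oSharedAction ρ U) +
        (β * oPosAction ρ U.timeReflect + β / 2 * oSharedAction ρ U) +
        β * oCrossAction ρ (translateLow Y U) by ring,
    Real.exp_add, Real.exp_add, Real.exp_add]
  push_cast
  ring

omit [Fact (1 < L)] in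
/-- The doubled integrand is measurable. [folklore] -/
theorem measurable_oIntegrand₂ (hρ : Continuous ρ) (β : ℝ) {g : GaugeConfig d L G → ℂ}
    (hg : Measurable g) : Measurable (oIntegrand₂ ρ hρ β g) := by
  have hg' := measurable_oObs ρ hρ β hg
  have hconj : Measurable (starRingEnd ℂ : ℂ → ℂ) := Complex.continuous_conj.measurable
  have hsp : Measurable (LatticeRP.splice lowerEdges :
      GaugeConfig d L G × GaugeConfig d L G → GaugeConfig d L G) := LatticeRP.measurable_splice _
  have hΘ1 : Measurable fun p : GaugeConfig d L G × GaugeConfig d L G => p.1.timeReflect :=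
    measurable_timeReflect.comp measurable_fst
  refine measurable_const.mul (((hg'.comp hsp).mul (hconj.comp (hg'.comp hΘ1))).mul
    (Complex.measurable_exp.comp (Finset.measurable_sum _ fun i _ => ?_)))
  exact ((measurable_oCoeff ρ hρ β i).comp hsp).mul (hconj.comp ((measurable_oCoeff ρ hρ β i).comp hΘ1))

omit [Fact (1 < L)] [MeasurableSpace G] [BorelSpace G] in
/-- The doubled integrand is bounded. [folklore] -/
theorem norm_oIntegrand₂_le (hρ : Continuous ρ) (β : ℝ) {g : GaugeConfig d L G → ℂ}
    {Kg : ℝ} (hgb : ∀ U, ‖g U‖ ≤ Kg) (p : GaugeConfig d L G × GaugeConfig d L G) :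
    ‖oIntegrand₂ ρ hρ β g p‖ ≤
      Real.exp (-β * (N * Fintype.card (Plaquette d L))) *
        ((|Kg| * Real.exp ((|β| + |β / 2|) * (N * Fintype.card (Plaquette d L)))) *
          (|Kg| * Real.exp ((|β| + |β / 2|) * (N * Fintype.card (Plaquette d L)))) *
          Real.exp (Fintype.card (CoeffIndex d L N) * (Real.sqrt (β / 2) * Real.sqrt (β / 2)))) := by
  unfold oIntegrand₂
  rw [norm_mul, Complex.norm_real, Real.norm_eq_abs, abs_of_pos (Real.exp_pos _)]
  refine mul_le_mul_of_nonneg_left ?_ (Real.exp_pos _).le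
  rw [norm_mul, norm_mul, Complex.norm_conj]
  refine mul_le_mul (mul_le_mul (norm_oObs_le ρ hρ β hgb _) (norm_oObs_le ρ hρ β hgb _)
    (norm_nonneg _) (by positivity)) ?_ (norm_nonneg _) (by positivity)
  rw [Complex.norm_exp]
  refine Real.exp_le_exp.2 ((Complex.re_le_norm _).trans ?_)
  calc ‖∑ i, oCoeff ρ hρ β i (LatticeRP.splice lowerEdges p) *
          (starRingEnd ℂ) (oCoeff ρ hρ β i p.1.timeReflect)‖
      ≤ ∑ i, ‖oCoeff ρ hρ β i (LatticeRP.splice lowerEdges p) *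
          (starRingEnd ℂ) (oCoeff ρ hρ β i p.1.timeReflect)‖ := norm_sum_le _ _
    _ ≤ ∑ _i : CoeffIndex d L N, Real.sqrt (β / 2) * Real.sqrt (β / 2) :=
        Finset.sum_le_sum fun i _ => by
          rw [norm_mul, Complex.norm_conj]
          exact mul_le_mul (norm_oCoeff_le ρ hρ β i _) (norm_oCoeff_le ρ hρ β i _) (norm_nonneg _)
            (Real.sqrt_nonneg _)
    _ = Fintype.card (CoeffIndex d L N) * (Real.sqrt (β / 2) * Real.sqrt (β / 2)) := by
        rw [Finset.sum_const, Finset.card_univ, nsmul_eq_mul]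

/-- **Reflection positivity of the un-normalised Wilson weight on the odd torus, covariant
form**: `0 ≤ ∫ exp(-β S(U)) Φ(U) ∏ dU_e`. [folklore] -/
theorem integral_oddCov_nonneg (hL : Odd L) (hρ : Continuous ρ) {β : ℝ} (hβ : 0 ≤ β)
    {K : Type*} [Fintype K] {g : K → GaugeConfig d L G → ℂ} (hgm : ∀ k, Measurable (g k))
    {Kg : ℝ} (hgb : ∀ k U, ‖g k U‖ ≤ Kg)
    (hgdep : ∀ k, DependsOn (g k)
      ((oPosEdges ∪ lowerEdges ∪ oSharedEdges : Finset (Edge d L)) : Set (Edge d L)))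
    {Φ : GaugeConfig d L G → ℂ} (hΦm : Measurable Φ)
    (hcov : ∀ U Y, Φ (translateLow Y U) =
      ∑ k, g k (LatticeRP.splice lowerEdges (U, Y)) * conj (g k U.timeReflect)) :
    0 ≤ ∫ U : GaugeConfig d L G, (Real.exp (-β * wilsonAction ρ U) : ℂ) * Φ U
      ∂(LatticeRP.piMeasure (haarProbability G)) := by
  set μ : Measure (GaugeConfig d L G) := LatticeRP.piMeasure (haarProbability G) with hμ
  set H : GaugeConfig d L G → ℂ := fun U => (Real.exp (-β * wilsonAction ρ U) : ℂ) * Φ U with hH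
  have hHm : Measurable H :=
    (Complex.measurable_ofReal.comp ((measurable_wilsonAction ρ hρ).const_mul (-β)).exp).mul hΦm
  have hR : ∀ U Y, H (translateLow Y U) = ∑ k, oIntegrand₂ ρ hρ β (g k) (U, Y) :=
    fun U Y => oIntegrand_translateLow ρ hL hρ hβ hcov U Y
  have hRi : ∀ k, Integrable (oIntegrand₂ ρ hρ β (g k)) (μ.prod μ) := fun k =>
    Integrable.of_bound (measurable_oIntegrand₂ ρ hρ β (hgm k)).aestronglyMeasurable _
      (ae_of_all _ (norm_oIntegrand₂_le ρ hρ β (hgb k)))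
  have step1 : ∫ U, H U ∂μ = ∫ Y, ∫ U, ∑ k, oIntegrand₂ ρ hρ β (g k) (U, Y) ∂μ ∂μ := by
    have hY : ∀ Y, ∫ U, H U ∂μ = ∫ U, ∑ k, oIntegrand₂ ρ hρ β (g k) (U, Y) ∂μ := fun Y => by
      rw [← LatticeRP.integral_comp_eq_of_measurePreserving (measurePreserving_translateLow Y) hHm]
      exact integral_congr_ae (ae_of_all _ fun U => hR U Y)
    calc ∫ U, H U ∂μ = ∫ _Y, (∫ U, H U ∂μ) ∂μ := by
          rw [integral_const, probReal_univ, one_smul]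
      _ = ∫ Y, ∫ U, ∑ k, oIntegrand₂ ρ hρ β (g k) (U, Y) ∂μ ∂μ :=
          integral_congr_ae (ae_of_all _ hY)
  have hsum : Integrable (fun p : GaugeConfig d L G × GaugeConfig d L G =>
      ∑ k, oIntegrand₂ ρ hρ β (g k) p) (μ.prod μ) :=
    integrable_finsetSum _ fun k _ => hRi k
  rw [step1, ← integral_prod_symm _ hsum, integral_finsetSum _ fun k _ => hRi k]
  refine Finset.sum_nonneg fun k _ => ?_
  unfold oIntegrand₂
  rw [integral_const_mul]
  refine mul_nonneg (Complex.zero_le_real.2 (Real.exp_pos _).le) ?_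
  exact LatticeRP.integral_mul_conj_mul_exp_nonneg_of_shared (haarProbability G) oSharedEdges
    oPosEdges lowerEdges GaugeConfig.timeReflect measurePreserving_timeReflect
    (fun U e he => timeReflect_apply_of_mem_oSharedEdges hL U e he)
    (fun e he => dependsOn_timeReflect_apply hL e he) disjoint_oSharedEdges_oPosEdges
    disjoint_oSharedEdges_lowerEdges (measurable_oObs ρ hρ β (hgm k))
    (fun i => measurable_oCoeff ρ hρ β i) (norm_oObs_le ρ hρ β (hgb k))
    (fun i U => norm_oCoeff_le ρ hρ β i U) (dependsOn_oObs ρ hL β (hgdep k))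
    (fun i => dependsOn_oCoeff ρ hL hρ β i)

end Assembly

end WilsonOddRP

/-! ## The theorems -/

section Main

variable {d L N : ℕ} {G : Type*} [Group G] [TopologicalSpace G] [IsTopologicalGroup G]
  [CompactSpace G] [MeasurableSpace G] [BorelSpace G] (ρ : G →* Matrix (Fin N) (Fin N) ℂ)

/-- **Osterwalder–Seiler reflection positivity on the odd torus, covariant form** (torus
`(ℤ/Lℤ)^d` with `L` odd, `L ≥ 3`; reflection `θ t = 1 - t` fixing the hyperplane between the
slices `0 | 1` and the site hyperplane `t = (L+1)/2`; continuous `ρ`, `β ≥ 0`; Osterwalder–Seiler,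
Ann. Phys. 110 (1978) 440, §2; Seiler LNP 159 Ch. 2; Fröhlich–Israel–Lieb–Simon, CMP 62 (1978),
Thm. 2.1 for the site hyperplane). If a measurable observable `Φ` satisfies, for all `U, Y`,
`Φ (translateLow Y U) = ∑ₖ gₖ(splice_C(U, Y)) · conj gₖ(Θ U)` for finitely many bounded measurable
`gₖ` depending only on the links of `P ∪ C ∪ M` (`WilsonOddRP.oPosEdges`: base point in
`1 ≤ t ≤ L/2`; `WilsonOddRP.lowerEdges`: temporal links `0 → 1`; `WilsonOddRP.oSharedEdges`:
spatial links of the slice `t = L/2 + 1`), then `⟨Φ⟩_{Λ,β} ≥ 0` (real and non-negative). [folklore] -/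
theorem wilsonExpectation_nonneg_of_oddCovariant [NeZero d] [NeZero L] (hL : Odd L) (hL3 : 3 ≤ L)
    (hρ : Continuous ρ) {β : ℝ} (hβ : 0 ≤ β)
    {K : Type*} [Fintype K] {g : K → GaugeConfig d L G → ℂ} (hgm : ∀ k, Measurable (g k))
    {Kg : ℝ} (hgb : ∀ k U, ‖g k U‖ ≤ Kg)
    (hgdep : ∀ k, DependsOn (g k)
      ((WilsonOddRP.oPosEdges ∪ WilsonOddRP.lowerEdges ∪ WilsonOddRP.oSharedEdges :
        Finset (Edge d L)) : Set (Edge d L)))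
    {Φ : GaugeConfig d L G → ℂ} (hΦm : Measurable Φ)
    (hcov : ∀ U Y, Φ (WilsonOddRP.translateLow Y U) =
      ∑ k, g k (LatticeRP.splice WilsonOddRP.lowerEdges (U, Y)) * conj (g k U.timeReflect)) :
    0 ≤ wilsonExpectation ρ β Φ := by
  haveI : Fact (1 < L) := ⟨by omega⟩
  have hdens : Measurable fun U : GaugeConfig d L G =>
      ENNReal.ofReal (Real.exp (-β * wilsonAction ρ U)) :=
    ENNReal.measurable_ofReal.comp ((WilsonRP.measurable_wilsonAction ρ hρ).const_mul (-β)).exp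
  unfold wilsonExpectation wilsonMeasure
  rw [integral_smul_measure]
  unfold wilsonWeight
  rw [integral_withDensity_eq_integral_toReal_smul hdens (ae_of_all _ fun _ => ENNReal.ofReal_lt_top)]
  simp_rw [ENNReal.toReal_ofReal (Real.exp_nonneg _), Complex.real_smul]
  refine mul_nonneg (Complex.zero_le_real.2 ENNReal.toReal_nonneg) ?_
  exact WilsonOddRP.integral_oddCov_nonneg ρ hL hρ hβ hgm hgb hgdep hΦm hcov

/-- **Osterwalder–Seiler reflection positivity on the odd torus** (plain form): for `L` odd,
`L ≥ 3`, continuous `ρ`, `β ≥ 0` and every bounded measurable observable `F` depending only on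
the links of `P ∪ M` (the closed positive half `1 ≤ t ≤ (L+1)/2` minus nothing: temporal links
based at `1 ≤ t ≤ L/2`, spatial links with `1 ≤ t ≤ L/2 + 1`), `⟨conj F(ΘU) · F(U)⟩_{Λ,β} ≥ 0`
for the reflection `θ t = 1 - t`. [folklore] -/
theorem wilsonExpectation_oddReflectionPositive [NeZero d] [NeZero L] (hL : Odd L) (hL3 : 3 ≤ L)
    (hρ : Continuous ρ) {β : ℝ} (hβ : 0 ≤ β) (F : GaugeConfig d L G → ℂ) (hF : Measurable F)
    (hFb : ∃ C : ℝ, ∀ U, ‖F U‖ ≤ C)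
    (hFdep : DependsOn F
      ((WilsonOddRP.oPosEdges ∪ WilsonOddRP.oSharedEdges : Finset (Edge d L)) : Set (Edge d L))) :
    0 ≤ wilsonExpectation ρ β fun U => conj (F U.timeReflect) * F U := by
  haveI : Fact (1 < L) := ⟨by omega⟩
  obtain ⟨CF, hFb⟩ := hFb
  have hFdep' : DependsOn F ((WilsonOddRP.oPosEdges ∪ WilsonOddRP.lowerEdges ∪
      WilsonOddRP.oSharedEdges : Finset (Edge d L)) : Set (Edge d L)) := fun U V hUV =>
    hFdep fun e he => hUV e (by
      rw [Finset.coe_union] at he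
      rcases he with he | he
      · simp [WilsonOddRP.mem_oPosEdges.1 he]
      · simp [WilsonOddRP.mem_oSharedEdges.1 he])
  have hPM : ∀ e : Edge d L, e ∈ ((WilsonOddRP.oPosEdges ∪ WilsonOddRP.oSharedEdges :
      Finset (Edge d L)) : Set (Edge d L)) → ¬ WilsonRP.IsLowerCross e := fun e he hc => by
    rw [Finset.coe_union] at he
    rcases he with he | he
    · exact WilsonOddRP.not_isOPosEdge_of_isLowerCross hc (WilsonOddRP.mem_oPosEdges.1 he)
    · exact WilsonOddRP.not_isOSharedEdge_of_isLowerCross hc (WilsonOddRP.mem_oSharedEdges.1 he)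
  refine wilsonExpectation_nonneg_of_oddCovariant ρ hL hL3 hρ hβ (K := Unit) (g := fun _ => F)
    (fun _ => hF) (fun _ U => hFb U) (fun _ => hFdep')
    ((Complex.continuous_conj.measurable.comp (hF.comp WilsonRP.measurable_timeReflect)).mul hF)
    fun U Y => ?_
  rw [Fintype.sum_unique, mul_comm]
  congr 1
  · exact hFdep fun e he => WilsonOddRP.translateLow_apply_of_not_isLowerCross Y U (hPM e he)
      |>.trans (WilsonOddRP.splice_apply_of_not_isLowerCross U Y (hPM e he)).symm
  · congr 1
    refine hFdep fun e he => ?_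
    have hne : ¬ WilsonRP.IsLowerCross (WilsonRP.edgeReflect e) := by
      intro hc
      have := WilsonOddRP.edgeReflect_of_isLowerCross (d := d) (L := L) hc
      rw [WilsonRP.edgeReflect_edgeReflect] at this
      rw [this] at he
      exact hPM _ he hc
    rw [WilsonRP.timeReflect_apply, WilsonRP.timeReflect_apply,
      WilsonOddRP.translateLow_apply_of_not_isLowerCross Y U hne]

end Main

end

end Literature.MathematicalPhysics.QuantumFieldTheory
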